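import Summits.QuantumAdvantage.QuantumAdvantage.Theorems.NearExactIsExact.Negative.XorBound

/-!
# Crux `CubicForrelation.NearExactIsExact` (stmt-QuantumAdvantage-14043) — negative side (disprover gen 26):
  MOVING corner flips attain the XOR bound too

Addendum to `…Negative.XorBound`.  There the dual table `Ψ(u,a) = C(u,a) ⊕ [a = 1…1]·e(u)` (fixed corner) was
shown to give `Φ(pcF C, pcG h) = 1 − 2·wt(e)/2^{m+m+k}` exactly.  Here the flipped frame value may MOVE with `u`:
`Ψ(u,a) = C(u,a) ⊕ [a = α(u)]·e(u)` for an arbitrary position map `α`; the value is the same (these are exactly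
the XOR-tight tables of the bound `xb_xor_bound`: one flipped entry on each `a`-cube where `e = 1`), hence the
same conditional criterion: moving-corner families of unbounded order would refute `NearExactIsExact`.
No such family is exhibited; this is NOT summit progress and NOT a refutation.  Proved from `xb_forrelation_pcF`,
`card_filter_append`, `xb_exists_order`, `pcF_isDegLeFun`, `pcG_isDegLeFun`; standard axioms. [this work]
-/

set_option linter.dupNamespace false -- D-0017: single-problem summit ⇒ `QuantumAdvantage.QuantumAdvantage` by design

noncomputable section

namespace Summit.QuantumAdvantage.QuantumAdvantage.Theorems.NearExactIsExact.Negative.MovingCorner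

open Finset
open Literature.Computability.QuantumComplexity
open Literature.Computability.QuantumComplexity.DerivativeWalsh (W)
open Summit.QuantumAdvantage.QuantumAdvantage.Theorems.CubicForrelation.NearExactIsExact
open Summit.QuantumAdvantage.QuantumAdvantage.Theorems.NearExactIsExact.Negative.ProjectionConcat
open Summit.QuantumAdvantage.QuantumAdvantage.Theorems.NearExactIsExact.Negative.XorBound

variable {M k : ℕ}

/-! ### Moving corner flips -/

/-- Moving-corner flip of a table: `Ψ(u,a) = C(u,a) ⊕ [a = α u]·e(u)`. -/
def movingCorner (C : (Fin M → Bool) → (Fin k → Bool) → Bool) (α : (Fin M → Bool) → (Fin k → Bool))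
    (e : (Fin M → Bool) → Bool) (u : Fin M → Bool) (a : Fin k → Bool) : Bool :=
  xor (C u a) (decide (a = α u) && e u)

/-- The corner flip is the moving corner with constant position `1…1`. -/
theorem cornerFlip_eq_movingCorner (C : (Fin M → Bool) → (Fin k → Bool) → Bool) (e : (Fin M → Bool) → Bool) :
    cornerFlip C e = movingCorner C (fun _ => ones) e := by
  funext u a
  by_cases ha : a = ones
  · subst ha
    simp [cornerFlip_ones, movingCorner]
  · have h0 : allOnes a = false := by
      cases h : allOnes a
      · rfl
      · exact absurd ((allOnes_eq_true_iff a).1 h) ha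
    simp [cornerFlip, movingCorner, h0, ha]

/-- **Moving-corner value.** If every slice `h_a` is bent with dual `movingCorner C α e (·) a`, then
`Φ(pcF C, pcG h) = 1 − 2·wt(e)/2^{m+m+k}` — the same value as the fixed corner flip. -/
theorem xb_forrelation_movingCorner {m k : ℕ} (h C : (Fin (m + m) → Bool) → (Fin k → Bool) → Bool)
    (α : (Fin (m + m) → Bool) → (Fin k → Bool)) (e : (Fin (m + m) → Bool) → Bool)
    (hd : ∀ a u, W (fun y => signOf (h y a)) u = (2 : ℝ) ^ m * signOf (movingCorner C α e u a)) :
    forrelation (pcF C) (pcG h) =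
      1 - 2 * ((univ.filter fun u => e u = true).card : ℝ) / 2 ^ (m + m + k) := by
  rw [xb_forrelation_pcF h (movingCorner C α e) C hd]
  have hc : (univ.filter fun v : Fin (m + m + k) → Bool =>
        C (fun i => v (Fin.castAdd k i)) (fun j => v (Fin.natAdd (m + m) j)) ≠
          movingCorner C α e (fun i => v (Fin.castAdd k i)) (fun j => v (Fin.natAdd (m + m) j))).card =
      (univ.filter fun u : Fin (m + m) → Bool => e u = true).card := by
    rw [card_filter_append (n₁ := m + m) (n₂ := k)]
    have key : ∀ u : Fin (m + m) → Bool,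
        (univ.filter fun a : Fin k → Bool =>
          C (fun i => Fin.append u a (Fin.castAdd k i)) (fun j => Fin.append u a (Fin.natAdd (m + m) j)) ≠
            movingCorner C α e (fun i => Fin.append u a (Fin.castAdd k i))
              (fun j => Fin.append u a (Fin.natAdd (m + m) j))).card = if e u = true then 1 else 0 := by
      intro u
      have hre : (univ.filter fun a : Fin k → Bool =>
          C (fun i => Fin.append u a (Fin.castAdd k i)) (fun j => Fin.append u a (Fin.natAdd (m + m) j)) ≠
            movingCorner C α e (fun i => Fin.append u a (Fin.castAdd k i))
              (fun j => Fin.append u a (Fin.natAdd (m + m) j))) =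
          univ.filter fun a : Fin k → Bool => a = α u ∧ e u = true := by
        refine filter_congr fun a _ => ?_
        simp only [Fin.append_left, Fin.append_right, movingCorner]
        by_cases ha : a = α u
        · cases C u a <;> cases e u <;> simp [ha]
        · cases C u a <;> cases e u <;> simp [ha]
      rw [hre]
      split_ifs with he
      · rw [show (univ.filter fun a : Fin k → Bool => a = α u ∧ e u = true) = {α u} from by
          ext a; simp [he]]
        rfl
      · rw [show (univ.filter fun a : Fin k → Bool => a = α u ∧ e u = true) = ∅ from by
          ext a; simp [he]]
        rfl
    simp_rw [key]
    rw [Finset.card_filter]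
  rw [hc]

/-- Bounds of the moving-corner value: `1 − 2/2^k ≤ Φ`, and `Φ < 1` as soon as `e ≠ 0`. -/
theorem xb_forrelation_movingCorner_bounds {m k : ℕ} (h C : (Fin (m + m) → Bool) → (Fin k → Bool) → Bool)
    (α : (Fin (m + m) → Bool) → (Fin k → Bool)) (e : (Fin (m + m) → Bool) → Bool)
    (hd : ∀ a u, W (fun y => signOf (h y a)) u = (2 : ℝ) ^ m * signOf (movingCorner C α e u a)) :
    1 - 2 / (2 : ℝ) ^ k ≤ forrelation (pcF C) (pcG h) ∧
      ((∃ u, e u = true) → forrelation (pcF C) (pcG h) < 1) := by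
  rw [xb_forrelation_movingCorner h C α e hd]
  have h1 : (0 : ℝ) < (2 : ℝ) ^ (m + m) := by positivity
  have h2 : (0 : ℝ) < (2 : ℝ) ^ k := by positivity
  have h12 : (0 : ℝ) < (2 : ℝ) ^ (m + m + k) := by positivity
  refine ⟨?_, fun ⟨u, hu⟩ => ?_⟩
  · have hw : ((univ.filter fun u : Fin (m + m) → Bool => e u = true).card : ℝ) ≤ (2 : ℝ) ^ (m + m) := by
      have := card_le_univ (univ.filter fun u : Fin (m + m) → Bool => e u = true)
      rw [Fintype.card_fun, Fintype.card_bool, Fintype.card_fin] at this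
      exact_mod_cast this
    have hratio : ((univ.filter fun u : Fin (m + m) → Bool => e u = true).card : ℝ) / (2 : ℝ) ^ (m + m) ≤ 1 := by
      rwa [div_le_one h1]
    have e1 : 2 * ((univ.filter fun u : Fin (m + m) → Bool => e u = true).card : ℝ) / (2 : ℝ) ^ (m + m + k) =
        2 / (2 : ℝ) ^ k *
          (((univ.filter fun u : Fin (m + m) → Bool => e u = true).card : ℝ) / (2 : ℝ) ^ (m + m)) := by
      rw [pow_add]
      field_simp
    rw [e1]
    have h3 : (0 : ℝ) ≤ 2 / (2 : ℝ) ^ k := by positivity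
    nlinarith [mul_le_mul_of_nonneg_left hratio h3]
  · have hpos : (1 : ℝ) ≤ ((univ.filter fun u : Fin (m + m) → Bool => e u = true).card : ℝ) := by
      have : 1 ≤ (univ.filter fun u : Fin (m + m) → Bool => e u = true).card :=
        card_pos.mpr ⟨u, mem_filter.mpr ⟨mem_univ u, hu⟩⟩
      exact_mod_cast this
    have : 0 < 2 * (((univ.filter fun u : Fin (m + m) → Bool => e u = true).card : ℝ)) / (2 : ℝ) ^ (m + m + k) := by
      positivity
    linarith

/-- **Moving-corner families of unbounded order would refute `NearExactIsExact`** (an implication; no such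
family is known): for every `j` some `k ≥ j`, jointly cubic tables `h`, `C` on `(m+m)+k` bits, a position map `α`
and `e ≠ 0` with every slice `h_a` bent of dual `u ↦ C(u,a) ⊕ [a = α u]·e(u)`. [this work] -/
theorem xb_nearExactIsExact_false_of_movingCornerFamilies
    (H : ∀ j : ℕ, ∃ m k : ℕ, j ≤ k ∧
      ∃ (h C : (Fin (m + m) → Bool) → (Fin k → Bool) → Bool) (α : (Fin (m + m) → Bool) → (Fin k → Bool))
        (e : (Fin (m + m) → Bool) → Bool),
        IsDegLeFun 3 (fun v : Fin (m + m + k) → Bool =>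
          h (fun i => v (Fin.castAdd k i)) (fun j => v (Fin.natAdd (m + m) j))) ∧
        IsDegLeFun 3 (fun v : Fin (m + m + k) → Bool =>
          C (fun i => v (Fin.castAdd k i)) (fun j => v (Fin.natAdd (m + m) j))) ∧
        (∃ u, e u = true) ∧
        ∀ a u, W (fun y => signOf (h y a)) u = (2 : ℝ) ^ m * signOf (movingCorner C α e u a)) :
    ¬ Summit.QuantumAdvantage.QuantumAdvantage.Theses.CubicForrelation.NearExactIsExact := by
  rintro ⟨θ, hθ, hiso⟩
  obtain ⟨k₀, hk₀⟩ := xb_exists_order θ hθ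
  obtain ⟨m, k, hjk, h, C, α, e, hh, hC, he, hd⟩ := H k₀
  have hn : Even (k + (m + m + k)) := ⟨m + k, by ring⟩
  have hF : IsDegLeFun 3 (pcF C) := pcF_isDegLeFun C hC
  have hG : IsDegLeFun 3 (pcG h) := pcG_isDegLeFun h hh
  obtain ⟨hge, hlt⟩ := xb_forrelation_movingCorner_bounds h C α e hd
  have hθΦ : θ < forrelation (pcF C) (pcG h) := lt_of_lt_of_le (hk₀ k hjk) hge
  have h1 := hiso (k + (m + m + k)) hn (pcF C) (pcG h) hF hG hθΦ
  linarith [hlt he]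

end Summit.QuantumAdvantage.QuantumAdvantage.Theorems.NearExactIsExact.Negative.MovingCorner

end
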